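import Summits.QuantumFields.YangMills.Theorems.BalabanUVNodesN24Stub1VWShareK1AxV11AERow

/-!
# BalabanUVNodes ∕ K1ᴬ LINE 2′ — N24's SHARES OF `stub_runRows13PWSVW` AND `stub_cont13VW` (registered skeleton v11.1 1c0150ff21ca0f8d on stmt-QuantumFields-27239) FROM NODE O's RUN-ROWS
# BILL AND THE (C) BILL, (signatures; the by-name ∕ route-decl readings are the thin sequel `…N24K1AxByNameOfBillsLine2VW`)

TRACK A (YM-PLAN §2d), node N24 (binder B2, COMPOSITE), seat `pub-ymgap-dag-n24-c` g24 (the -a hand on LINE 2′ per `K1AX-V11-LINE-TABLE.md` v4), `--kind proof --supports stmt-QuantumFields-27239 --as helper` (count-neutral; conditional producers of the stubs' texts — the stubs stay OPEN until every bill is paid).  Sequel of `…N24Stub1VWShareK1AxV11AERow` (rung 1ⱽᵂ from the per-node bills, N13's bill in the K1ᴬ ENGINE's currency — (2.50) at every `U` at level 0, `dV`-a.e. at levels ≥ 1, `SLaw`-guarded — the revision built inside, Theorem-1-free).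

WHAT IS HERE (theorems only; 0 `def`, 0 `sorry`, standard axioms):
* §1 `N24_runRowsAtSomeRecord13PWSVW_of_bodyAt_of_rows` ∕ `N24_runRowsContAtSomeRecord13PWSVW_of_bodyAt_of_rows_of_cont` — rungs 2ⱽᵂ ∕ 2ⱽᵂ‴ BY NAME at a KEPT rung-1ⱽᵂ witness, the run
  rows (i)–(iv) (+ (C) at the same level) attached with the ceiling match `B + r ≤ w.βup`.
* §2 ★★ `stub2TextVW_of_bills_atWitnessFamily` ∕ `stub3TextVW_of_bills_atWitnessFamily` — `stub_runRows13PWSVW` ∕ `stub_cont13VW`'s SIGNATURES from the rung-1 per-node bills (parent's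
  shapes) + NODE O's RUN-ROWS BILL `hrows` (+ the (C) BILL `hC`) read AT A WITNESS FAMILY `Θ F i` (engine §3 shape; dag-lead GATE v1.273 (c)): the stub's hypothesis yields rung 0 at `F`, hence a
  member `i` (`hK0`); the bills REBUILD the revision and the S-bound world AT `Θ F i` with the ceiling letter `βup := B + r` (parent `N24_rung1VW_bodyAt_of_bills_at_aeRow`; «a prover may keep stub 1's
  witness or re-choose it» — re-chosen at the family's θ), (C) at the level `min γ₀ γc`.  ★★ `stub3TextVW_of_contBill` — `stub_cont13VW`'s text with the rows witness KEPT, from a ∀θ (C) bill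
  with a per-θ radius `γc` (WEAKER than the kit's ∀θ ∀γ₀≤θ.γ letter `Cont13All`): rows cut to `min γ₀ γc` (`RunConstRemainder.mono`, the floor antitone in the level).
* (THESES-FREE: the stubs' SIGNATURES are concluded here; their by-name readings `K1AxV11StubTexts.Stub{1,2,3}TextVW` and K1ᴬ BY ITS ROUTE NAME through
  `stabilityBRunRowsAtRecordR13SepCoPHVAx_of_stubTextsVW` are the thin sequel `…N24K1AxByNameOfBillsLine2VW`, which alone imports the route cone.)

WHICH CHILD BLOCKS K1ᴬ ON LINE 2′ (kernel form = the sequel's one theorem = the union of the hypothesis lists below, BY NAME, at the family `Θ F i`): N05 `h05` · N06 `h06` · N07 `h07` · N08 `h08` · N09 `h09` + `h09T` · N10 `h10` · N11 `h11` ·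
𝐑 `hR` · N12 `h12` (payable only at live-selector members, dag-n12-d I.22983) · N13 `h13` (the ENGINE's binder verbatim; rung 1ⱽᵂ) · NODE O `hrows` ([I] Thm 3 (5.10) p.293 is printed for the small-field actions only; the floor
is the AF-sign content, T09.F, printed nowhere) · (C) `hC` ([I] §1 pp.263–264, asserted without proof).
HONEST SCOPE ∕ A6.  Implications only; every bill is a DISPLAYED hypothesis, inhabited at NO θ here; nothing of Bałaban asserted; no registered stub closed; K1ᴬ OPEN (v11.1 0∕6, never summed
across lines); N24 COMPOSITE — no discharge, no count claim (discharged 8∕27 · K 1∕4 unmoved).  One finite 𝕋⁴ programme at fixed ε, Bałaban AS PRINTED; R4 would close ONLY the conditional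
finite-𝕋⁴ rung `BalabanLadder.UV` — the YM mass gap (Clay) is NOT proved by any of this; nothing continuum ∕ ℝ⁴ ∕ OS.  No `def`, no `instance`, no `sorry`.
References (bookkeeping only): [Balaban1987RG1] Thm 3 p.264, (1.20)–(1.22) p.264, (5.10) p.293, §1 pp.263–264; [Balaban1988RG2Cluster] (2.41) p.21; [Balaban1989LargeFieldII] Thm 1 p.355, (0.1) pp.355–356.
-/

noncomputable section

open scoped BigOperators
open MeasureTheory

namespace Summit.QuantumFields.YangMills.BalabanUVNodes.N24Stub23VWShareK1AxV11

open Literature.MathematicalPhysics.QuantumFieldTheory.Balaban1983to89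
open Literature.MathematicalPhysics.QuantumFieldTheory.Balaban1983to89.Node00
open DagBinding T4Continuum FlowStepRuns
open FlowStep (RGEqH prefixOf)
open Summit.QuantumFields.YangMills.Theorems.BalabanUVNodesK2NamedJetsRunRemAt (RunConstRemainder SurvCont)
open Summit.QuantumFields.YangMills.Theorems.K1AxV11Defs (Inhabited13 RecordSV NodesAtSomeRecord13PWSVW RunRowsAtSomeRecord13PWSVW RunRowsContAtSomeRecord13PWSVW)
open Summit.QuantumFields.YangMills.BalabanUVNodes.N24Stub1VWShareK1AxV11AERow (N24_rung1VW_bodyAt_of_bills_at_aeRow stub1TextVW_of_bills_atWitnessFamily_aeRow)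

variable {F : T4Family}

/-! ## §1. Rungs 2ⱽᵂ ∕ 2ⱽᵂ‴ BY NAME at a KEPT rung-1ⱽᵂ witness -/

/-- **RUNG 2ⱽᵂ `K1AxV11Defs.RunRowsAtSomeRecord13PWSVW F` BY NAME AT A KEPT RUNG-1ⱽᵂ WITNESS**: rung 1ⱽᵂ's body at `(θ, h, v, w)` (e.g. the parent's `N24_rung1VW_bodyAt_pointed` ∕
`N24_rung1VW_bodyAt_of_bills_at_aeRow`) and the run rows (i)–(iv) of `β_θ := betaOfRecord₁₃Ax θ` on a level `γ₀ > 0` with the ceiling match `B + r ≤ w.βup` ⟹ rung 2ⱽᵂ (which drops N08's sentence and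
the [IV] pin; the nodes stay window-guarded).  COMPOSITE; nothing is discharged. [cite: Balaban1987RG1, Thm 3 p.264, (1.22) p.264, (5.10) p.293; Balaban1988RG2Cluster, (2.41) p.21 (statement shapes; bookkeeping)] -/
theorem N24_runRowsAtSomeRecord13PWSVW_of_bodyAt_of_rows (θ : Stage13HParams F 2) (h : θ.Provisos₁₃SepCoPHAx F 2) (v : Revision₁₃Ax F 2 θ h) (w : WorldP)
    (hbody : (θ.ZhUnity F 2 ∧ θ.SlotsNondegenerate₁₃Ax F 2) ∧ θ.Admissible F 2 ∧ RecordSV F θ h v w ∧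
      (∀ P : B12.RunParams, (leavesP w P).smallCouplings → Nodes (leavesP w P)) ∧ PrintedUV3V 2 θ.L ∧
      ∃ lam : ResidW F 2, (∀ P : B12.RunParams, 1 ≤ P.K → lam.kSel P < P.K) ∧
        ∀ P : B12.RunParams, lam.kSel P < P.K → (leavesP w P).smallCouplings → ((leavesP w P).rBasicStep ↔ B15Leaf (WOfRecord₁₃Ax F 2 θ.toStage13Params lam P)))
    {b : ℕ → ℝ} {r γ₀ B M : ℝ} (hγ₀ : 0 < γ₀) (hrem : RunConstRemainder (betaOfRecord₁₃Ax F 2 θ.toStage13Params) b r γ₀) (hB : ∀ k, b k ≤ B) (hmatch : B + r ≤ w.βup)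
    (hps : ∀ (n : ℕ) (gs : ℕ → ℝ), RGEqH n (betaOfRecord₁₃Ax F 2 θ.toStage13Params) gs → Step.InInterval γ₀ n gs →
      ∀ k, k ≤ n → -M ≤ ∑ j ∈ Finset.Ico k n, betaOfRecord₁₃Ax F 2 θ.toStage13Params j (prefixOf gs j)) :
    RunRowsAtSomeRecord13PWSVW F :=
  ⟨θ, h, v, w, hbody.1, hbody.2.1, hbody.2.2.1, hbody.2.2.2.1, b, r, γ₀, B, M, hγ₀, hrem, hB, hmatch, hps⟩

/-- **RUNG 2ⱽᵂ‴ `K1AxV11Defs.RunRowsContAtSomeRecord13PWSVW F` BY NAME AT A KEPT RUNG-1ⱽᵂ WITNESS**: as above plus (C) `SurvCont β_θ γ₀` at the SAME level.  COMPOSITE; nothing is discharged.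
[cite: Balaban1987RG1, Thm 3 p.264, (1.22) p.264, §1 pp.263–264 (statement shapes; bookkeeping)] -/
theorem N24_runRowsContAtSomeRecord13PWSVW_of_bodyAt_of_rows_of_cont (θ : Stage13HParams F 2) (h : θ.Provisos₁₃SepCoPHAx F 2) (v : Revision₁₃Ax F 2 θ h) (w : WorldP)
    (hbody : (θ.ZhUnity F 2 ∧ θ.SlotsNondegenerate₁₃Ax F 2) ∧ θ.Admissible F 2 ∧ RecordSV F θ h v w ∧
      (∀ P : B12.RunParams, (leavesP w P).smallCouplings → Nodes (leavesP w P)) ∧ PrintedUV3V 2 θ.L ∧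
      ∃ lam : ResidW F 2, (∀ P : B12.RunParams, 1 ≤ P.K → lam.kSel P < P.K) ∧
        ∀ P : B12.RunParams, lam.kSel P < P.K → (leavesP w P).smallCouplings → ((leavesP w P).rBasicStep ↔ B15Leaf (WOfRecord₁₃Ax F 2 θ.toStage13Params lam P)))
    {b : ℕ → ℝ} {r γ₀ B M : ℝ} (hγ₀ : 0 < γ₀) (hrem : RunConstRemainder (betaOfRecord₁₃Ax F 2 θ.toStage13Params) b r γ₀) (hB : ∀ k, b k ≤ B) (hmatch : B + r ≤ w.βup)
    (hps : ∀ (n : ℕ) (gs : ℕ → ℝ), RGEqH n (betaOfRecord₁₃Ax F 2 θ.toStage13Params) gs → Step.InInterval γ₀ n gs →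
      ∀ k, k ≤ n → -M ≤ ∑ j ∈ Finset.Ico k n, betaOfRecord₁₃Ax F 2 θ.toStage13Params j (prefixOf gs j))
    (hsc : SurvCont (betaOfRecord₁₃Ax F 2 θ.toStage13Params) γ₀) :
    RunRowsContAtSomeRecord13PWSVW F :=
  ⟨θ, h, v, w, hbody.1, hbody.2.1, hbody.2.2.1, hbody.2.2.2.1, b, r, γ₀, B, M, hγ₀, hrem, hB, hmatch, hps, hsc⟩

/-! ## §2. ★★ The texts of `stub_runRows13PWSVW` and `stub_cont13VW` from the bills -/

/-- **★★ `stub_runRows13PWSVW`'s TEXT FROM THE RUNG-1 PER-NODE BILLS AND NODE O's RUN-ROWS BILL AT A WITNESS FAMILY.**  The stub's hypothesis `NodesAtSomeRecord13PWSVW F` yields rung 0 at `F`,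
hence a member `i` of the family (`hK0`); NODE O's bill `hrows` at `Θ F i` gives the rows (i) `RunConstRemainder (betaOfRecord₁₃Ax θ) b r γ₀`, (ii) `b ≤ B`, (iv) the partial-sum floor `−M` on
`γ₀ > 0`; the rung-1 bills at `Θ F i` REBUILD the revision and the S-bound world with the ceiling letter `βup := B + r` (parent `N24_rung1VW_bodyAt_of_bills_at_aeRow`), so (iii) `B + r ≤ w.βup` holds
by construction — the witness is RE-CHOSEN at the family's θ («a prover may keep stub 1's witness or re-choose it»).  CONDITIONAL; closes nothing; nothing of Bałaban asserted.
[cite: Balaban1987RG1, Thm 3 p.264, (1.20)–(1.22) p.264, (5.10) p.293; Balaban1988RG2Cluster, (2.41) p.21; Balaban1989LargeFieldII, Thm 1 p.355, (0.1) pp.355–356 (statement shapes; bookkeeping)] -/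
theorem stub2TextVW_of_bills_atWitnessFamily (ι : T4Family → Type) (Θ : ∀ F : T4Family, ι F → Stage13HParams F 2) (hK0 : ∀ F : T4Family, Inhabited13 F → Nonempty (ι F))
    (hP : ∀ (F : T4Family) (i : ι F), (Θ F i).Provisos₁₃SepCoPHAx F 2) (hU : ∀ (F : T4Family) (i : ι F), (Θ F i).ZhUnity F 2 ∧ (Θ F i).SlotsNondegenerate₁₃Ax F 2)
    (hθ : ∀ (F : T4Family) (i : ι F), (Θ F i).Admissible F 2)
    (h05 : ∀ (F : T4Family) (i : ι F), ∃ lam8 : ResidB8 (Θ F i).toStage3Params, B8LeafOfRecordSubBH (Θ F i).toStage3Params lam8)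
    (h06 : ∀ (F : T4Family) (_ : ι F), ∃ Y₀ : PrintedCarriers9X, B9LeafX Y₀)
    (h07 : ∀ (F : T4Family) (_ : ι F), ∃ ζ : ResidZ F 2, B11Leaf (Z11OfRecord F 2 ζ))
    (h08 : ∀ (F : T4Family) (i : ι F), PrintedUV3V 2 (Θ F i).L)
    (h09 : ∀ (F : T4Family) (i : ι F), ∃ lam12 : ResidB12 F 2 (Θ F i).τ9.M,
      ∀ P : B12.RunParams, B12Sec2to5.Lemma4Printed (F12OfRecord₁₂ F 2 (Θ F i).toStage12Params lam12 P) (lam12 P).consts)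
    (h09T : ∀ (F : T4Family) (i : ι F), ∃ γ₉ : ℝ, 0 < γ₉ ∧ ∀ w : WorldP, w.C = (datumOfRecord₁₃SepCoPHAx F 2 (Θ F i) (hP F i)).C → w.γ ≤ γ₉ →
      ∀ P : B12.RunParams, (leavesP w P).smallCouplings → (leavesP w P).smallFieldInductive)
    (h10 : ∀ (F : T4Family) (i : ι F), ∃ lam13 : B12.RunParams → ResidB13 (Θ F i).toStage3Params, ∀ P : B12.RunParams, B13LeafOfRecord (Θ F i).toStage3Params (lam13 P))
    (h11 : ∀ (F : T4Family) (i : ι F), ∀ βup β₀ : ℝ, ∃ γ₁₁ : ℝ, 0 < γ₁₁ ∧ ∀ w : WorldP, w.C = (datumOfRecord₁₃SepCoPHAx F 2 (Θ F i) (hP F i)).C → w.βup = βup → w.β₀ = β₀ → w.γ ≤ γ₁₁ →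
      ∀ P : B12.RunParams, (leavesP w P).b7 → (leavesP w P).b8 → (leavesP w P).b9 → (leavesP w P).b10 → (leavesP w P).b11 →
        (leavesP w P).smallCouplings → (leavesP w P).smallFieldInductive → (leavesP w P).flowControl →
          ∀ k, k < P.K → SLaw₁₃CoPHChi F 2 (Θ F i) (chiβOfRecord₁₃Ax F 2 (Θ F i).toStage13Params) P k → TLaw₁₃CoPHChi F 2 (Θ F i) (chiβOfRecord₁₃Ax F 2 (Θ F i).toStage13Params) P k)
    (hR : ∀ (F : T4Family) (i : ι F) (P : B12.RunParams) (k : ℕ), k < P.K →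
      TLaw₁₃CoPHChi F 2 (Θ F i) (chiβOfRecord₁₃Ax F 2 (Θ F i).toStage13Params) P k → SLaw₁₃CoPHChi F 2 (Θ F i) (chiβOfRecord₁₃Ax F 2 (Θ F i).toStage13Params) P (k + 1))
    (h12 : ∀ (F : T4Family) (i : ι F), ∃ (lamW : ResidW F 2) (γ₁₂ : ℝ), 0 < γ₁₂ ∧ (∀ P : B12.RunParams, 1 ≤ P.K → lamW.kSel P < P.K) ∧
      ∀ P : B12.RunParams, lamW.kSel P < P.K → Step.InInterval γ₁₂ P.K (gOfRecord₁₃Ax F 2 (Θ F i).toStage13Params P) → B15Leaf (WOfRecord₁₃Ax F 2 (Θ F i).toStage13Params lamW P))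
    (h13 : ∀ (F : T4Family) (i : ι F), ∃ γ₁₃ : ℝ, 0 < γ₁₃ ∧ ∃ em ep : ℝ → ℝ,
        (∀ P : B12.RunParams, ((datumOfRecord₁₃SepCoPHAx F 2 (Θ F i) (hP F i)).C P).flow.InInterval γ₁₃ P.K → SLaw₁₃CoPHChi F 2 (Θ F i) (chiβOfRecord₁₃Ax F 2 (Θ F i).toStage13Params) P 0 →
      ∀ U : GaugeField (F.P P.K) 0 (SU 2),
        chiβOfRecord₁₃Ax F 2 (Θ F i).toStage13Params P.K (gOfRecord₁₃Ax F 2 (Θ F i).toStage13Params P) 0 U *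
              Real.exp (-(1 / (gOfRecord₁₃Ax F 2 (Θ F i).toStage13Params P 0) ^ 2 * wilsonBGOfRecord F 2 (Θ F i).εbg P 0 U)
                - em (gOfRecord₁₃Ax F 2 (Θ F i).toStage13Params P 0) * (Fintype.card (Site (F.P P.K) 0) : ℝ)) ≤ densOfRecord₁₃Chi F 2 (Θ F i).toStage13Params (chiβOfRecord₁₃Ax F 2 (Θ F i).toStage13Params) P 0 U ∧
          densOfRecord₁₃Chi F 2 (Θ F i).toStage13Params (chiβOfRecord₁₃Ax F 2 (Θ F i).toStage13Params) P 0 U ≤ Real.exp (ep (gOfRecord₁₃Ax F 2 (Θ F i).toStage13Params P 0) * (Fintype.card (Site (F.P P.K) 0) : ℝ))) ∧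
        (∀ P : B12.RunParams, ((datumOfRecord₁₃SepCoPHAx F 2 (Θ F i) (hP F i)).C P).flow.InInterval γ₁₃ P.K → ∀ k, k + 1 ≤ P.K → SLaw₁₃CoPHChi F 2 (Θ F i) (chiβOfRecord₁₃Ax F 2 (Θ F i).toStage13Params) P (k + 1) →
      ∀ᵐ U ∂(fieldMeasure (F.P P.K) (k + 1) (SU 2)),
        chiβOfRecord₁₃Ax F 2 (Θ F i).toStage13Params P.K (gOfRecord₁₃Ax F 2 (Θ F i).toStage13Params P) (k + 1) U *
              Real.exp (-(1 / (gOfRecord₁₃Ax F 2 (Θ F i).toStage13Params P (k + 1)) ^ 2 * wilsonBGOfRecord F 2 (Θ F i).εbg P (k + 1) U)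
                - em (gOfRecord₁₃Ax F 2 (Θ F i).toStage13Params P (k + 1)) * (Fintype.card (Site (F.P P.K) (k + 1)) : ℝ)) ≤ densOfRecord₁₃Chi F 2 (Θ F i).toStage13Params (chiβOfRecord₁₃Ax F 2 (Θ F i).toStage13Params) P (k + 1) U ∧
          densOfRecord₁₃Chi F 2 (Θ F i).toStage13Params (chiβOfRecord₁₃Ax F 2 (Θ F i).toStage13Params) P (k + 1) U ≤ Real.exp (ep (gOfRecord₁₃Ax F 2 (Θ F i).toStage13Params P (k + 1)) * (Fintype.card (Site (F.P P.K) (k + 1)) : ℝ))))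
    (hrows : ∀ (F : T4Family) (i : ι F), ∃ (b : ℕ → ℝ) (r γ₀ B M : ℝ), 0 < γ₀ ∧ RunConstRemainder (betaOfRecord₁₃Ax F 2 (Θ F i).toStage13Params) b r γ₀ ∧ (∀ k, b k ≤ B) ∧
      ∀ (n : ℕ) (gs : ℕ → ℝ), RGEqH n (betaOfRecord₁₃Ax F 2 (Θ F i).toStage13Params) gs → Step.InInterval γ₀ n gs →
        ∀ k, k ≤ n → -M ≤ ∑ j ∈ Finset.Ico k n, betaOfRecord₁₃Ax F 2 (Θ F i).toStage13Params j (prefixOf gs j))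
    :
    ∀ F : T4Family, NodesAtSomeRecord13PWSVW F → RunRowsAtSomeRecord13PWSVW F := by
  intro F hN
  obtain ⟨θ₀, h₀, -, -, hU₀, hθ₀, -⟩ := hN
  obtain ⟨i⟩ := hK0 F ⟨θ₀, h₀, hU₀, hθ₀⟩
  obtain ⟨b, r, γ₀, B, M, hγ₀, hrem, hB, hps⟩ := hrows F i
  obtain ⟨v, w, hβup, -, hbody⟩ := N24_rung1VW_bodyAt_of_bills_at_aeRow F (Θ F i) (hP F i) (hU F i) (hθ F i) (h05 F i) (h06 F i) (h07 F i) (h08 F i) (h09 F i)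
    (h09T F i) (h10 F i) (h11 F i) (hR F i) (h12 F i) (h13 F i) (B + r)
  exact N24_runRowsAtSomeRecord13PWSVW_of_bodyAt_of_rows (Θ F i) (hP F i) v w hbody hγ₀ hrem hB (le_of_eq hβup.symm) hps

/-- **★★ `stub_cont13VW`'s TEXT FROM THE BILLS AT A WITNESS FAMILY** (rows AND (C) rebuilt at the family's θ; (C) attached at the level `min γ₀ γc`, the rows cut there by `RunConstRemainder.mono`
and the antitone floor).  CONDITIONAL; closes nothing; (C) is [I] §1 pp.263–264's continuity of the effective-action coefficients in the couplings, asserted in print WITHOUT proof.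
[cite: Balaban1987RG1, §1 pp.263–264, Thm 3 p.264, (1.22) p.264, (5.10) p.293; Balaban1989LargeFieldII, Thm 1 p.355 (statement shapes; bookkeeping)] -/
theorem stub3TextVW_of_bills_atWitnessFamily (ι : T4Family → Type) (Θ : ∀ F : T4Family, ι F → Stage13HParams F 2) (hK0 : ∀ F : T4Family, Inhabited13 F → Nonempty (ι F))
    (hP : ∀ (F : T4Family) (i : ι F), (Θ F i).Provisos₁₃SepCoPHAx F 2) (hU : ∀ (F : T4Family) (i : ι F), (Θ F i).ZhUnity F 2 ∧ (Θ F i).SlotsNondegenerate₁₃Ax F 2)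
    (hθ : ∀ (F : T4Family) (i : ι F), (Θ F i).Admissible F 2)
    (h05 : ∀ (F : T4Family) (i : ι F), ∃ lam8 : ResidB8 (Θ F i).toStage3Params, B8LeafOfRecordSubBH (Θ F i).toStage3Params lam8)
    (h06 : ∀ (F : T4Family) (_ : ι F), ∃ Y₀ : PrintedCarriers9X, B9LeafX Y₀)
    (h07 : ∀ (F : T4Family) (_ : ι F), ∃ ζ : ResidZ F 2, B11Leaf (Z11OfRecord F 2 ζ))
    (h08 : ∀ (F : T4Family) (i : ι F), PrintedUV3V 2 (Θ F i).L)
    (h09 : ∀ (F : T4Family) (i : ι F), ∃ lam12 : ResidB12 F 2 (Θ F i).τ9.M,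
      ∀ P : B12.RunParams, B12Sec2to5.Lemma4Printed (F12OfRecord₁₂ F 2 (Θ F i).toStage12Params lam12 P) (lam12 P).consts)
    (h09T : ∀ (F : T4Family) (i : ι F), ∃ γ₉ : ℝ, 0 < γ₉ ∧ ∀ w : WorldP, w.C = (datumOfRecord₁₃SepCoPHAx F 2 (Θ F i) (hP F i)).C → w.γ ≤ γ₉ →
      ∀ P : B12.RunParams, (leavesP w P).smallCouplings → (leavesP w P).smallFieldInductive)
    (h10 : ∀ (F : T4Family) (i : ι F), ∃ lam13 : B12.RunParams → ResidB13 (Θ F i).toStage3Params, ∀ P : B12.RunParams, B13LeafOfRecord (Θ F i).toStage3Params (lam13 P))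
    (h11 : ∀ (F : T4Family) (i : ι F), ∀ βup β₀ : ℝ, ∃ γ₁₁ : ℝ, 0 < γ₁₁ ∧ ∀ w : WorldP, w.C = (datumOfRecord₁₃SepCoPHAx F 2 (Θ F i) (hP F i)).C → w.βup = βup → w.β₀ = β₀ → w.γ ≤ γ₁₁ →
      ∀ P : B12.RunParams, (leavesP w P).b7 → (leavesP w P).b8 → (leavesP w P).b9 → (leavesP w P).b10 → (leavesP w P).b11 →
        (leavesP w P).smallCouplings → (leavesP w P).smallFieldInductive → (leavesP w P).flowControl →
          ∀ k, k < P.K → SLaw₁₃CoPHChi F 2 (Θ F i) (chiβOfRecord₁₃Ax F 2 (Θ F i).toStage13Params) P k → TLaw₁₃CoPHChi F 2 (Θ F i) (chiβOfRecord₁₃Ax F 2 (Θ F i).toStage13Params) P k)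
    (hR : ∀ (F : T4Family) (i : ι F) (P : B12.RunParams) (k : ℕ), k < P.K →
      TLaw₁₃CoPHChi F 2 (Θ F i) (chiβOfRecord₁₃Ax F 2 (Θ F i).toStage13Params) P k → SLaw₁₃CoPHChi F 2 (Θ F i) (chiβOfRecord₁₃Ax F 2 (Θ F i).toStage13Params) P (k + 1))
    (h12 : ∀ (F : T4Family) (i : ι F), ∃ (lamW : ResidW F 2) (γ₁₂ : ℝ), 0 < γ₁₂ ∧ (∀ P : B12.RunParams, 1 ≤ P.K → lamW.kSel P < P.K) ∧
      ∀ P : B12.RunParams, lamW.kSel P < P.K → Step.InInterval γ₁₂ P.K (gOfRecord₁₃Ax F 2 (Θ F i).toStage13Params P) → B15Leaf (WOfRecord₁₃Ax F 2 (Θ F i).toStage13Params lamW P))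
    (h13 : ∀ (F : T4Family) (i : ι F), ∃ γ₁₃ : ℝ, 0 < γ₁₃ ∧ ∃ em ep : ℝ → ℝ,
        (∀ P : B12.RunParams, ((datumOfRecord₁₃SepCoPHAx F 2 (Θ F i) (hP F i)).C P).flow.InInterval γ₁₃ P.K → SLaw₁₃CoPHChi F 2 (Θ F i) (chiβOfRecord₁₃Ax F 2 (Θ F i).toStage13Params) P 0 →
      ∀ U : GaugeField (F.P P.K) 0 (SU 2),
        chiβOfRecord₁₃Ax F 2 (Θ F i).toStage13Params P.K (gOfRecord₁₃Ax F 2 (Θ F i).toStage13Params P) 0 U *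
              Real.exp (-(1 / (gOfRecord₁₃Ax F 2 (Θ F i).toStage13Params P 0) ^ 2 * wilsonBGOfRecord F 2 (Θ F i).εbg P 0 U)
                - em (gOfRecord₁₃Ax F 2 (Θ F i).toStage13Params P 0) * (Fintype.card (Site (F.P P.K) 0) : ℝ)) ≤ densOfRecord₁₃Chi F 2 (Θ F i).toStage13Params (chiβOfRecord₁₃Ax F 2 (Θ F i).toStage13Params) P 0 U ∧
          densOfRecord₁₃Chi F 2 (Θ F i).toStage13Params (chiβOfRecord₁₃Ax F 2 (Θ F i).toStage13Params) P 0 U ≤ Real.exp (ep (gOfRecord₁₃Ax F 2 (Θ F i).toStage13Params P 0) * (Fintype.card (Site (F.P P.K) 0) : ℝ))) ∧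
        (∀ P : B12.RunParams, ((datumOfRecord₁₃SepCoPHAx F 2 (Θ F i) (hP F i)).C P).flow.InInterval γ₁₃ P.K → ∀ k, k + 1 ≤ P.K → SLaw₁₃CoPHChi F 2 (Θ F i) (chiβOfRecord₁₃Ax F 2 (Θ F i).toStage13Params) P (k + 1) →
      ∀ᵐ U ∂(fieldMeasure (F.P P.K) (k + 1) (SU 2)),
        chiβOfRecord₁₃Ax F 2 (Θ F i).toStage13Params P.K (gOfRecord₁₃Ax F 2 (Θ F i).toStage13Params P) (k + 1) U *
              Real.exp (-(1 / (gOfRecord₁₃Ax F 2 (Θ F i).toStage13Params P (k + 1)) ^ 2 * wilsonBGOfRecord F 2 (Θ F i).εbg P (k + 1) U)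
                - em (gOfRecord₁₃Ax F 2 (Θ F i).toStage13Params P (k + 1)) * (Fintype.card (Site (F.P P.K) (k + 1)) : ℝ)) ≤ densOfRecord₁₃Chi F 2 (Θ F i).toStage13Params (chiβOfRecord₁₃Ax F 2 (Θ F i).toStage13Params) P (k + 1) U ∧
          densOfRecord₁₃Chi F 2 (Θ F i).toStage13Params (chiβOfRecord₁₃Ax F 2 (Θ F i).toStage13Params) P (k + 1) U ≤ Real.exp (ep (gOfRecord₁₃Ax F 2 (Θ F i).toStage13Params P (k + 1)) * (Fintype.card (Site (F.P P.K) (k + 1)) : ℝ))))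
    (hrows : ∀ (F : T4Family) (i : ι F), ∃ (b : ℕ → ℝ) (r γ₀ B M : ℝ), 0 < γ₀ ∧ RunConstRemainder (betaOfRecord₁₃Ax F 2 (Θ F i).toStage13Params) b r γ₀ ∧ (∀ k, b k ≤ B) ∧
      ∀ (n : ℕ) (gs : ℕ → ℝ), RGEqH n (betaOfRecord₁₃Ax F 2 (Θ F i).toStage13Params) gs → Step.InInterval γ₀ n gs →
        ∀ k, k ≤ n → -M ≤ ∑ j ∈ Finset.Ico k n, betaOfRecord₁₃Ax F 2 (Θ F i).toStage13Params j (prefixOf gs j))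
    (hC : ∀ (F : T4Family) (i : ι F), ∃ γc : ℝ, 0 < γc ∧ ∀ γ₀ : ℝ, 0 < γ₀ → γ₀ ≤ γc → SurvCont (betaOfRecord₁₃Ax F 2 (Θ F i).toStage13Params) γ₀)
    :
    ∀ F : T4Family, RunRowsAtSomeRecord13PWSVW F → RunRowsContAtSomeRecord13PWSVW F := by
  intro F hN
  obtain ⟨θ₀, h₀, -, -, hU₀, hθ₀, -⟩ := hN
  obtain ⟨i⟩ := hK0 F ⟨θ₀, h₀, hU₀, hθ₀⟩
  obtain ⟨b, r, γ₀, B, M, hγ₀, hrem, hB, hps⟩ := hrows F i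
  obtain ⟨γc, hγc, hsc⟩ := hC F i
  obtain ⟨v, w, hβup, -, hbody⟩ := N24_rung1VW_bodyAt_of_bills_at_aeRow F (Θ F i) (hP F i) (hU F i) (hθ F i) (h05 F i) (h06 F i) (h07 F i) (h08 F i) (h09 F i)
    (h09T F i) (h10 F i) (h11 F i) (hR F i) (h12 F i) (h13 F i) (B + r)
  have hγ₁ : 0 < min γ₀ γc := lt_min hγ₀ hγc
  exact N24_runRowsContAtSomeRecord13PWSVW_of_bodyAt_of_rows_of_cont (Θ F i) (hP F i) v w hbody hγ₁ (hrem.mono (min_le_left _ _)) hB (le_of_eq hβup.symm)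
    (fun n gs hrg hI k hk => hps n gs hrg (fun j hj => ⟨(hI j hj).1, (hI j hj).2.trans (min_le_left _ _)⟩) k hk) (hsc _ hγ₁ (min_le_right _ _))

/-- **★★ `stub_cont13VW`'s TEXT WITH THE ROWS WITNESS KEPT, FROM A ∀θ (C) BILL WITH A PER-θ RADIUS**: at the rows witness `(θ, h, v, w)` (opaque, KEPT), `hC` at θ gives `γc > 0` below which the
record's β has run-wise SURVIVOR CONTINUITY; cut the rows to `min γ₀ γc` and attach (C) there — the kit's `stubCont13VW_of_cont13All` with the ∀θ ∀γ₀≤θ.γ letter `Cont13All` replaced by a per-θ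
radius (WEAKER; no presenting parameter read).  Use only if (C) is payable at EVERY rung-0 θ; else the family version above.  CONDITIONAL; closes nothing.
[cite: Balaban1987RG1, §1 pp.263–264, Thm 3 p.264, (1.22) p.264 (statement shapes; bookkeeping)] -/
theorem stub3TextVW_of_contBill
    (hC : ∀ (F : T4Family) (θ : Stage13HParams F 2), θ.Provisos₁₃SepCoPHAx F 2 → (θ.ZhUnity F 2 ∧ θ.SlotsNondegenerate₁₃Ax F 2) → θ.Admissible F 2 →
      ∃ γc : ℝ, 0 < γc ∧ ∀ γ₀ : ℝ, 0 < γ₀ → γ₀ ≤ γc → SurvCont (betaOfRecord₁₃Ax F 2 θ.toStage13Params) γ₀) :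
    ∀ F : T4Family, RunRowsAtSomeRecord13PWSVW F → RunRowsContAtSomeRecord13PWSVW F := by
  intro F hrows
  obtain ⟨θ, h, v, w, hU, hθ, hR, hnodes, b, r, γ₀, B, M, hγ₀, hrem, hB, hmatch, hps⟩ := hrows
  obtain ⟨γc, hγc, hsc⟩ := hC F θ h hU hθ
  have hγ₁ : 0 < min γ₀ γc := lt_min hγ₀ hγc
  refine ⟨θ, h, v, w, hU, hθ, hR, hnodes, b, r, min γ₀ γc, B, M, hγ₁, hrem.mono (min_le_left _ _), hB, hmatch, ?_, hsc _ hγ₁ (min_le_right _ _)⟩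
  intro n gs hrg hI k hk
  exact hps n gs hrg (fun j hj => ⟨(hI j hj).1, (hI j hj).2.trans (min_le_left _ _)⟩) k hk

end Summit.QuantumFields.YangMills.BalabanUVNodes.N24Stub23VWShareK1AxV11

end
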